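import Literature.MathematicalPhysics.QuantumFieldTheory.Balaban1983to89.B9PinGeometryKLevelV1
import Literature.MathematicalPhysics.QuantumFieldTheory.Balaban1983to89.B9Thm314GpFlatOmegaOff
import Literature.MathematicalPhysics.QuantumFieldTheory.Balaban1983to89.B9Thm314

/-!
# `Balaban1983to89.B9Thm314WholePinGeometry` — [B9] Theorem 3.14 (pp. 426–427): the GEOMETRIC half of the displayed leaf
# `B9Thm314.LocData` ∕ `LocData.Laws` of the printed proof ((3.93) ∕ (3.154)) AT def-Y's pinned geometry `geo9Y` ∕ `dOmegaY` ∕ `unitDistY`,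
# kernel-checked on the torus of record — companion of `B9Thm314Whole`

T. Bałaban, *Propagators for lattice gauge theories in a background field*, Commun. Math. Phys. **99** (1985) 389–434
[`Balaban1985BackgroundPropagators`, "B9"]; [4] = [`Balaban1984PropagatorsII`].  p. 427: *"d(y, y′, Ω) = inf_{y₁∈Ωᶜ∩T^{(k)}}(|y − y₁| +
|y₁ − y′|) (3.154)"*; p. 410 (3.93): *"d(ω, y, y′) = inf (d(y, y₁) + d(y₁, y₂) + … + d(y_n, y′))"*; [4] (2.46) p. 231 (the multiscale distance d as the
infimum over admissible contours), (2.54) p. 233 (its triangle inequality).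

statement-level skeleton of published theorems with citation tags; proofs where landed; nothing here is a claim about the Yang–Mills mass gap

THE POINT.  `B9Thm314Whole.thm314_pair_of_leaves` (rows 22–23 of the N06 certificate) displays, per member, a `B9Thm314.LocData (geo i) (bg i) (Ediff i)`
with its `LocData.Laws (dOmega i)`: ten fields, of which SIX are pure geometry of (3.93)∕(3.154) — `ρ_self`, `ρ_symm`, `ρ_triangle` (|·| of `T^{(k)}` is a
pseudo-distance), `d_triangle` ((2.54) for the member's d), `cmp` (|y − y′| ≤ d(y, y′): the lattice distance is dominated by the multiscale distance) and
`dOmega_le` ((3.154) is below every competitor) — and FOUR concern the localisation domains of the expansion's walks (`near`, `first_mem`, `chain`, and the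
datum `diam`), i.e. the operator layer.  AT def-Y's PIN (`B9PinGeometryKLevelV1`: sites = index bonds of the member's first sequence `x.D`, `(geo9Y x).dist` = the
admissible-contour distance (2.46) of their carrier blocks on the torus, `unitDistY` ∕ `dOmegaY` = p21's `tdistK` ∕ `dOmega` on the `k`-block labels `kLab`) the six
geometric fields are THEOREMS; this file proves them and packages the pinned `LocData` (`locDataY`: `Pt :=` the `k`-block labels, `ι := kLab x`, `ρ := tdistK`,
`inΩc := (· ∈ OmegaC x.D x.D′)`; `X`, `Meets`, `diam` parameters) with `locDataY_laws` reducing `Laws (dOmegaY x)` to the four operator-layer fields.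
* §1 (the torus of record, any family `D`): `blk_top_eq_of_blkOf_eq` (the sites of one block of 𝔅 lie in one `k`-block — (2.1) nesting),
  `tdistK_blk_le_one_of_touchT` (two TOUCHING blocks have `k`-labels at |·|-distance ≤ 1: a site is within `(Lᵏ − 1)∕2` of its `k`-block centre, touching
  sites are within 1), ★ `tdistK_blk_le_distT` (**|y − y′| ≤ d(y, y′)** for the `k`-labels of ANY two sites against the (2.46)-distance of their blocks —
  induction on a shortest admissible contour; n06-a's `B9Thm314GpFlatOmegaOff.tdistK_le_distT_of_top` is the top-block case).
* §2 (a member `x`): `unitDistY_le_dist` (= `cmp`), `unitDistY_self`, `isPseudoDist_unitDistY` (row 24's `Static315.pdist` via `IsPseudoDist.comp`),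
  `dist_triangle_geo9Y` (= `d_triangle`, `B6Geom246MultiLevelTorus.triangle_refl_nonneg_T`), `dOmegaY_le_of_mem_OmegaC` (= `dOmega_le`, p21's `dOmega_le`).
* §3 `locDataY`, `locDataY_laws`.
HONEST SCOPE: pure lattice geometry of the record's tori; the four operator-layer fields stay hypotheses; nothing of [B9]'s estimates; count-neutral; NOT a node
discharge; nothing continuum, nothing about the mass gap.  Cell `pub-ymgap` (D-0062), node N06 [B9], N06-ASSIGNMENT v1 rows 22–23 (follow-up), seat
`pub-ymgap-dag-n06-m`, 2026-08-26.
-/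

namespace Literature.MathematicalPhysics.QuantumFieldTheory.Balaban1983to89.B9Thm314WholePinGeometry

open Finset
open B4Reflection242 (boxDom blk)
open B4Thm110ZeroBox (blk_blk)
open B6MultiLevelBoxOperator
open B6MultiLevelTorusOperator
open B6Geom246MultiLevelBox
open B6Geom246MultiLevelTorus
open B9Thm314GpFlatTorusGeometry (tdistK dOmega cenB cenLab dist_toR_cenB_le OmegaC dOmega_le)
open B9Thm314QGGQInvFlatTransfer (tdistK_triangle tdistK_comm)
open B9Thm314GpFlatOmegaOff (tdistK_self)
open B6SectAOperatorsV1 (BondIdx)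
open B6GlobalChartV1 (toBox domT)
open B6Ineq2142KLevelV1 (baseSite)
open B9PinMembersKLevelV1 (MemberY geo9Y)
open B9PinGeometryKLevelV1 (kLab dOmegaY unitDistY)

noncomputable section

variable {d : ℕ}

/-! ## §1 The torus of record: `k`-labels of sites against the admissible-contour distance of their blocks -/

section Torus

variable {ℓ Mh k R : ℕ} {P : Fin (d + 1) → ℕ} (D : TDomains d ℓ Mh k P R)

/-- **THE SITES OF ONE BLOCK OF 𝔅 LIE IN ONE `k`-BLOCK** ((2.1): a block of level `j ≤ k` is a union-cell of the `Lᵏ`-partition): two sites with the same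
block have the same `k`-block label. [cite: Balaban1984PropagatorsII, (2.1) p.224 («B^j(y) … big blocks»), dictionary] -/
theorem blk_top_eq_of_blkOf_eq {x z : ↥(boxDom (N0 ℓ Mh k P))} (h : blkOf D.toDomains x = blkOf D.toDomains z) :
    blk ((ℓ + 1) ^ k) x.1 = blk ((ℓ + 1) ^ k) z.1 := by
  set s := blkOf D.toDomains z with hs
  have hj : s.1.1 ≤ k := (scale_bounds D.toDomains s).2
  have hx : blk ((ℓ + 1) ^ s.1.1) x.1 = s.1.2 := (blkOf_eq_iff_blk D.toDomains).1 h
  have hz : blk ((ℓ + 1) ^ s.1.1) z.1 = s.1.2 := (blkOf_eq_iff_blk D.toDomains).1 rfl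
  have hpow : (ℓ + 1) ^ s.1.1 * (ℓ + 1) ^ (k - s.1.1) = (ℓ + 1) ^ k := by
    rw [← pow_add, Nat.add_sub_cancel' hj]
  rw [← hpow, ← blk_blk, ← blk_blk, hx, hz]

/-- **TOUCHING BLOCKS HAVE `k`-LABELS AT |·|-DISTANCE ≤ 1** (in units of `Lᵏ`): a site is within `(Lᵏ − 1)∕2` of the centre of its `k`-block
(`dist_toR_cenB_le`), touching blocks contain sites at torus distance ≤ 1 (`TouchT`), every site of a block has the block's `k`-label
(`blk_top_eq_of_blkOf_eq`). [cite: Balaban1984PropagatorsII, (2.46) p.231 («admissible bonds»); Balaban1985BackgroundPropagators, (3.154) p.427 («|y − y₁|»)] -/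
theorem tdistK_blk_le_one_of_touchT {s t : ↥(bset D.toDomains)} (h : TouchT D s t) {z z' : ↥(boxDom (N0 ℓ Mh k P))}
    (hz : blkOf D.toDomains z = s) (hz' : blkOf D.toDomains z' = t) :
    tdistK (ℓ := ℓ) (Mh := Mh) (k := k) (P := P) (blk ((ℓ + 1) ^ k) z.1) (blk ((ℓ + 1) ^ k) z'.1) ≤ 1 := by
  obtain ⟨x, x', hx, hx', hd⟩ := h
  have hN := one_le_of_mem x.2
  have hxz : blk ((ℓ + 1) ^ k) z.1 = blk ((ℓ + 1) ^ k) x.1 := blk_top_eq_of_blkOf_eq D (hz.trans hx.symm)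
  have hxz' : blk ((ℓ + 1) ^ k) z'.1 = blk ((ℓ + 1) ^ k) x'.1 := blk_top_eq_of_blkOf_eq D (hz'.trans hx'.symm)
  set Lk : ℝ := (((ℓ + 1) ^ k : ℕ) : ℝ) with hLk
  have hLk1 : (1 : ℕ) ≤ (ℓ + 1) ^ k := Nat.one_le_pow _ _ (by omega)
  have hLk0 : 0 < Lk := by rw [hLk]; exact_mod_cast lt_of_lt_of_le Nat.zero_lt_one hLk1
  have hc : ∀ y : ↥(boxDom (N0 ℓ Mh k P)),
      dist (toT (N0 ℓ Mh k P) (toR y.1)) (toT (N0 ℓ Mh k P) (cenB ((ℓ + 1) ^ k) y.1)) ≤ (Lk - 1) / 2 := fun y =>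
    (dist_toT_le hN _ _).trans (dist_toR_cenB_le hLk1 y.1)
  have h12 : dist (toT (N0 ℓ Mh k P) (toR x.1)) (toT (N0 ℓ Mh k P) (toR x'.1)) ≤ 1 := by
    rw [dist_toT_toR hN]; exact hd
  have htot : dist (toT (N0 ℓ Mh k P) (cenB ((ℓ + 1) ^ k) x.1)) (toT (N0 ℓ Mh k P) (cenB ((ℓ + 1) ^ k) x'.1)) ≤ Lk := by
    have h1 := hc x
    have h2 := hc x'
    rw [dist_comm] at h1
    calc dist (toT (N0 ℓ Mh k P) (cenB ((ℓ + 1) ^ k) x.1)) (toT (N0 ℓ Mh k P) (cenB ((ℓ + 1) ^ k) x'.1))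
        ≤ dist (toT (N0 ℓ Mh k P) (cenB ((ℓ + 1) ^ k) x.1)) (toT (N0 ℓ Mh k P) (toR x.1))
            + dist (toT (N0 ℓ Mh k P) (toR x.1)) (toT (N0 ℓ Mh k P) (toR x'.1))
            + dist (toT (N0 ℓ Mh k P) (toR x'.1)) (toT (N0 ℓ Mh k P) (cenB ((ℓ + 1) ^ k) x'.1)) := dist_triangle4 _ _ _ _
      _ ≤ (Lk - 1) / 2 + 1 + (Lk - 1) / 2 := by linarith
      _ = Lk := by ring
  rw [hxz, hxz']
  unfold tdistK
  rw [div_le_one hLk0]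
  exact htot

/-- along an admissible contour from the block of `z` to the block of `z′` the `k`-labels move by at most one unit per bond.
[cite: Balaban1984PropagatorsII, (2.46) p.231; Balaban1985BackgroundPropagators, (3.154) p.427] -/
theorem tdistK_blk_le_length :
    ∀ {s t : ↥(bset D.toDomains)} (p : (bondT D).Walk s t) {z z' : ↥(boxDom (N0 ℓ Mh k P))},
      blkOf D.toDomains z = s → blkOf D.toDomains z' = t →
        tdistK (ℓ := ℓ) (Mh := Mh) (k := k) (P := P) (blk ((ℓ + 1) ^ k) z.1) (blk ((ℓ + 1) ^ k) z'.1) ≤ (p.length : ℝ) := by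
  intro s t p
  induction p with
  | nil =>
    intro z z' hz hz'
    rw [blk_top_eq_of_blkOf_eq D (hz.trans hz'.symm), tdistK_self, SimpleGraph.Walk.length_nil, Nat.cast_zero]
  | @cons a b c hab p ih =>
    intro z z' hz hz'
    obtain ⟨w, hw⟩ := exists_blkOf_eq D.toDomains b
    have h1 := tdistK_blk_le_one_of_touchT D (bondT_adj.1 hab).2 hz hw
    have h2 := ih hw hz'
    rw [SimpleGraph.Walk.length_cons, Nat.cast_add, Nat.cast_one]
    exact (tdistK_triangle _ _ _).trans (by linarith)

/-- ★ **|y − y′| ≤ d(y, y′)**: the |·|-distance on `T^{(k)}` of the `k`-labels of ANY two sites is at most the multiscale distance (2.46) of their blocks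
(a shortest admissible contour exists, `connectedT`) — the field `cmp` of `B9Thm314.LocData.Laws` at the torus of record.  (n06-a's
`B9Thm314GpFlatOmegaOff.tdistK_le_distT_of_top` is the case of two top blocks.) [cite: Balaban1984PropagatorsII, (2.46) p.231; Balaban1985BackgroundPropagators, (3.93) p.410 + (3.154) p.427] -/
theorem tdistK_blk_le_distT (hMh : 1 ≤ Mh) (hP : ∀ μ, 1 ≤ P μ) (z z' : ↥(boxDom (N0 ℓ Mh k P))) :
    tdistK (ℓ := ℓ) (Mh := Mh) (k := k) (P := P) (blk ((ℓ + 1) ^ k) z.1) (blk ((ℓ + 1) ^ k) z'.1)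
      ≤ (geomT D).dist (blkOf D.toDomains z) (blkOf D.toDomains z') := by
  obtain ⟨p, hp⟩ := (connectedT (D := D) hMh hP).exists_walk_length_eq_dist (blkOf D.toDomains z) (blkOf D.toDomains z')
  have h := tdistK_blk_le_length D p rfl rfl
  rw [hp] at h
  exact h

end Torus

/-! ## §2 At a member of def-Y's index: the six geometric fields of `LocData.Laws` -/

section Member

variable {ℓ : ℕ} {hd : 1 ≤ d + 1} {hL : Odd (ℓ + 1) ∧ 1 < ℓ + 1} {b₀ b₁ : ℝ} {Mstar : ℕ} (x : MemberY d ℓ hd hL b₀ b₁ Mstar)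

/-- `1 ≤ M_h` at a member (from `8 ≤ M_h`). [cite: Balaban1984PropagatorsII, (2.1) p.224, bookkeeping] -/
theorem one_le_Mh : 1 ≤ x.Mh := le_trans (by norm_num) x.hM8

/-- `1 ≤ P_μ` at a member (from `5 ≤ P_μ`). [cite: Balaban1984PropagatorsII, (2.1) p.224, bookkeeping] -/
theorem one_le_P (μ : Fin (d + 1)) : 1 ≤ x.P' μ := le_trans (by norm_num) (x.hP5 μ)

/-- **`cmp` AT THE PIN: `|y − y′| ≤ d(y, y′)`** — def-Y's `unitDistY` (|·| on `T^{(k)}` between the `k`-labels of two index bonds) is at most the member's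
multiscale distance `(geo9Y x).dist` (the (2.46)-distance of the carrier blocks of their base points). [cite: Balaban1984PropagatorsII, (2.46) p.231; Balaban1985BackgroundPropagators, (3.154) p.427] -/
theorem unitDistY_le_dist (b b' : BondIdx (domT x.hN x.D x.hk)) : unitDistY x b b' ≤ (geo9Y x).dist b b' :=
  tdistK_blk_le_distT x.D (one_le_Mh x) (one_le_P x) (toBox x.hN (baseSite x.hN x.D x.hk b)) (toBox x.hN (baseSite x.hN x.D x.hk b'))

/-- `|y − y| = 0`. [cite: Balaban1985BackgroundPropagators, (3.154) p.427, dictionary] -/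
theorem unitDistY_self (b : BondIdx (domT x.hN x.D x.hk)) : unitDistY x b b = 0 :=
  tdistK_self _

/-- **|·| on `T^{(k)}` IS A PSEUDO-DISTANCE at a member** (`B4Sect5Torus.IsPseudoDist (unitDistY x)`: def-Y's `unitDistY_comm`∕`_triangle` and `unitDistY_self`) —
the field `Static315.pdist` of `B9Thm315Whole` (row 24) follows by `IsPseudoDist.comp` along the placing map `e`.
[cite: Balaban1985BackgroundPropagators, (3.187) p.432 + (3.154) p.427, dictionary] -/
theorem isPseudoDist_unitDistY : B4Sect5Torus.IsPseudoDist (unitDistY x) :=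
  ⟨B9PinGeometryKLevelV1.unitDistY_comm x, unitDistY_self x, B9PinGeometryKLevelV1.unitDistY_triangle x⟩

/-- **`d_triangle` AT THE PIN**: (2.54) for the member's multiscale distance. [cite: Balaban1984PropagatorsII, (2.54) p.233] -/
theorem dist_triangle_geo9Y (b b' b'' : BondIdx (domT x.hN x.D x.hk)) :
    (geo9Y x).dist b b'' ≤ (geo9Y x).dist b b' + (geo9Y x).dist b' b'' :=
  (triangle_refl_nonneg_T x.D (one_le_Mh x) (one_le_P x)).1 _ _ _

/-- **`dOmega_le` AT THE PIN**: (3.154) is below `|y − y₁| + |y₁ − y′|` for every `y₁ ∈ Ωᶜ ∩ T^{(k)}` (p21's `dOmega_le` at the labels of the two bonds).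
[cite: Balaban1985BackgroundPropagators, (3.154) p.427] -/
theorem dOmegaY_le_of_mem_OmegaC {q : Fin (d + 1) → ℤ} (hq : q ∈ OmegaC x.D x.D') (b b' : BondIdx (domT x.hN x.D x.hk)) :
    dOmegaY x b b' ≤ tdistK (ℓ := ℓ) (Mh := x.Mh) (k := x.k) (P := x.P') (kLab x b) q
      + tdistK (ℓ := ℓ) (Mh := x.Mh) (k := x.k) (P := x.P') q (kLab x b') :=
  dOmega_le x.D x.D' hq

end Member

/-! ## §3 The pinned `LocData` and its laws modulo the operator layer -/

section Pinned

variable {ℓ : ℕ} {hd : 1 ≤ d + 1} {hL : Odd (ℓ + 1) ∧ 1 < ℓ + 1} {b₀ b₁ : ℝ} {Mstar : ℕ} (x : MemberY d ℓ hd hL b₀ b₁ Mstar)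
  {B : B9.Backgrounds} (E : B9.RWExpansion (geo9Y x) B)

/-- **THE GEOMETRIC DATA OF (3.93)∕(3.154) AT def-Y's PIN**: the point set of `T^{(k)}` = the `k`-block labels, `ι := kLab x`, `ρ :=` p21's `tdistK` (= `unitDistY`
on labels), `inΩc := (· ∈ Ωᶜ ∩ T^{(k)})` = p21's `OmegaC x.D x.D′`; the localisation domains `X`, their meeting predicate `Meets` and the datum `diam` are the
expansion's (parameters).  A reading; nothing asserted. [cite: Balaban1985BackgroundPropagators, (3.93) p.410 + (3.154) p.427] -/
def locDataY (X : E.Walk → ℕ → (geo9Y x).Site → Prop) (Meets : E.Walk → ℕ → Prop) (diam : ℝ) : B9Thm314.LocData (geo9Y x) B E where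
  Pt := Fin (d + 1) → ℤ
  ι := kLab x
  ρ := fun β β' => tdistK (ℓ := ℓ) (Mh := x.Mh) (k := x.k) (P := x.P') β β'
  inΩc := fun q => q ∈ OmegaC x.D x.D'
  X := X
  Meets := Meets
  diam := diam

/-- the pinned `ρ` on the labels of two bonds IS `unitDistY` (by `rfl`). [cite: Balaban1985BackgroundPropagators, (3.154) p.427, dictionary] -/
theorem locDataY_ρ_kLab (X : E.Walk → ℕ → (geo9Y x).Site → Prop) (Meets : E.Walk → ℕ → Prop) (diam : ℝ)
    (b b' : BondIdx (domT x.hN x.D x.hk)) :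
    (locDataY x E X Meets diam).ρ (kLab x b) (kLab x b') = unitDistY x b b' :=
  rfl

/-- ★ **`LocData.Laws (dOmegaY x)` AT THE PIN, MODULO THE OPERATOR LAYER**: the six geometric fields are §1–§2's theorems (`tdistK_self`, `tdistK_comm`,
`tdistK_triangle`, (2.54) `dist_triangle_geo9Y`, `cmp` = `unitDistY_le_dist`, (3.154) `dOmegaY_le_of_mem_OmegaC`); displayed remain the four fields about the
walks' localisation domains — `near` (a domain meeting Ωᶜ lies within `diam` of Ωᶜ ∩ T^{(k)} in |·|), `first_mem` (y ∈ X₀), `chain` ((3.93) attained or undercut by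
a chain through X₁, …, X_n). [cite: Balaban1985BackgroundPropagators, (3.93) p.410 + (3.154) p.427; Balaban1984PropagatorsII, (2.46) p.231 + (2.54) p.233] -/
theorem locDataY_laws {X : E.Walk → ℕ → (geo9Y x).Site → Prop} {Meets : E.Walk → ℕ → Prop} {diam : ℝ}
    (near : ∀ ω m p, Meets ω m → X ω m p → ∃ q, q ∈ OmegaC x.D x.D' ∧
      tdistK (ℓ := ℓ) (Mh := x.Mh) (k := x.k) (P := x.P') (kLab x p) q ≤ diam)
    (first_mem : ∀ ω y, E.first ω y → X ω 0 y)
    (chain : ∀ ω y y', E.first ω y → E.last ω y' →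
      ∃ l : List (geo9Y x).Site, l.length = E.wlen ω ∧ (∀ (m : ℕ) (hm : m < l.length), X ω (m + 1) (l[m])) ∧
        B9Thm314.chainSum (geo9Y x).dist y l y' ≤ E.wdist ω y y') :
    (locDataY x E X Meets diam).Laws (dOmegaY x) where
  ρ_self := fun _ => tdistK_self _
  ρ_symm := fun _ _ => tdistK_comm _ _
  ρ_triangle := fun _ _ _ => tdistK_triangle _ _ _
  d_triangle := dist_triangle_geo9Y x
  cmp := unitDistY_le_dist x
  dOmega_le := fun b b' _ hq => dOmegaY_le_of_mem_OmegaC x hq b b'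
  near := near
  first_mem := first_mem
  chain := chain

end Pinned

end

end Literature.MathematicalPhysics.QuantumFieldTheory.Balaban1983to89.B9Thm314WholePinGeometry
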